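import Summits.AtomisticToContinuum.Crystallization.Theses.ThreeConeCertificate
import Summits.AtomisticToContinuum.Crystallization.Theorems.SlackRigidity.Negative.WitnessBasics
import Summits.AtomisticToContinuum.Crystallization.Theorems.ThreeConeCertificateSlackRigidityRodDefs
import Summits.AtomisticToContinuum.Crystallization.Theorems.ThreeConeCertificateSlackRigidityRodProfile
import Summits.AtomisticToContinuum.Crystallization.Theorems.ThreeConeCertificateSlackRigidityRodSlice
import Summits.AtomisticToContinuum.Crystallization.Theorems.ThreeConeCertificateSlackRigidityRootingField
import Summits.AtomisticToContinuum.Crystallization.Theorems.ThreeConeCertificateSlackRigidityLocalLimitField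
import Summits.AtomisticToContinuum.Crystallization.Theorems.ThreeConeCertificateSlackRigidityLayerUnfolding
import Summits.AtomisticToContinuum.Crystallization.Theorems.ThreeConeCertificateSlackRigidityRodLemma
import Summits.AtomisticToContinuum.Crystallization.Theorems.ThreeConeCertificateSlackRigidityReduction
import Summits.AtomisticToContinuum.Crystallization.Theorems.ThreeConeCertificateSlackRigidityLayeringIdeal
import Literature.MathematicalPhysics.StatisticalMechanics.LennardJonesClusters
import Literature.MathematicalPhysics.StatisticalMechanics.LocalMatchingCompactness
import Literature.MathematicalPhysics.StatisticalMechanics.BarlowStacking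
import Mathlib.Analysis.Fourier.FourierTransform
import Mathlib.Analysis.SpecialFunctions.Complex.Log
import HarnessLib

/-!
# Crux `SlackRigidity` (stmt-AtomisticToContinuum-11960), line `signed-root-silent-field`:
# the TRANSFER `LocalisedCertificate ⇒ SlackRigidity`, kernel-checked

`slackRigidity_of_localisedCertificate`: the localised exact three-cone certificate (the line's only
open stub `stub_certificate` — crux 11959 `ExactCertificate` at `P = hcp(a,h)` strengthened by the
smearing representation `f = K ⋆ K` with a continuous `O(r⁻⁴)` kernel, the star form of `c`-stability
with a continuous star functional, the weak tight locus at radius `6a/5`, and the single-shell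
selection clause `𝓕K̃ ≠ 0`, `C²` on `4/(3a²) + 1/(4h²) < |ξ|² < 4/(3a²) + 1/h²`) IMPLIES the crux
`ThreeConeCertificate.SlackRigidity` by name.  All six true-mathematics stubs of the line are landed
theorems and are used here: rooting with the field channel (`SignedRootRooting.stub_rootingField`),
the silent local limit (`SignedRootLocalLimit.stub_localLimitField`), torus-section unfolding
(`SignedRootUnfolding.stub_layerUnfolding`), regularity and Fourier slice of the rod profile
(`SignedRootProfile.stub_rodProfile`, `SignedRootSlice.stub_rodSlice`), and the 1-D spectral lemma
(`SignedRootRodLemma.stub_rodLemma`); with the landed c-layer machinery (thinning, layering on the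
window, alternating word ⇒ hcp) and the trial-state bound.  Composition as in the line skeleton
`Cruxes/SlackRigidity/Lines/signed-root-silent-field.lean` (`SlackRigidity_of`). [folklore]
-/

noncomputable section

open scoped BigOperators Topology FourierTransform
open MeasureTheory Filter Set Metric
open Literature.MathematicalPhysics.StatisticalMechanics
open Summit.AtomisticToContinuum.Crystallization.Theses.ThreeConeCertificate (SlackRigidity)
open Summit.AtomisticToContinuum.Crystallization.Theorems.SlackRigidityNegative
  (E3 Good badCount BadFractionVanishes ExcessVanishes RigidFor slackRigidity_iff)
open Summit.AtomisticToContinuum.Crystallization.Theorems.SignedRootSilentField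
  (E2 rodDual rodPoint rodProfile rodPhase norm_rodPoint_sq)
open Summit.AtomisticToContinuum.Crystallization.Theorems

namespace Summit.AtomisticToContinuum.Crystallization.Theorems.SignedRootReduction

/-! ### Glue lemmas (sorry-free) -/

/-- **Silence is transported by a linear isometry**: if `A '' S` is silent then `S` is silent
(`K` enters only through distances). [folklore] -/
theorem silent_of_silent_image {K : ℝ → ℝ} {S : Set E3} (A : E3 →ₗᵢ[ℝ] E3)
    (hsil : ∀ y : E3, HasSum (fun q : ↥(A '' S) => K ‖y - (q : E3)‖) 0) :
    ∀ y : E3, HasSum (fun p : ↥S => K ‖y - (p : E3)‖) 0 := by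
  intro y
  have h := hsil (A y)
  set e : ↥S ≃ ↥(A '' S) := Equiv.Set.image A S A.injective with he
  rw [← e.hasSum_iff] at h
  convert h using 1
  funext p
  simp only [Function.comp_apply]
  have hp : ((e p : ↥(A '' S)) : E3) = A (p : E3) := rfl
  rw [hp, ← map_sub, LinearIsometry.norm_map]

/-- **Two-periodic layer phases ⇒ alternating Hägg word**: `ω^{L_{k+2}} = ω^{L_k}` with `ω` a primitive
cube root of unity forces `3 ∣ s k + s (k+1)`, hence `s (k+1) = −s k` for a `±1` word. [folklore] -/
theorem succ_eq_neg_of_rodPhase_periodic {s : ℤ → ℤ} (hs : IsHaggSeq s)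
    (hper : ∀ k : ℤ, rodPhase s (k + 2) = rodPhase s k) (m : ℤ) : s (m + 1) = -s m := by
  have h := hper m
  rw [rodPhase, rodPhase, Complex.exp_eq_exp_iff_exists_int] at h
  obtain ⟨n, hn⟩ := h
  have hL : haggLabel s (m + 2) = haggLabel s m + s m + s (m + 1) := by
    rw [show m + 2 = m + 1 + 1 by ring, haggLabel_succ, haggLabel_succ]
  have hπ : (2 * (Real.pi : ℂ) * Complex.I) ≠ 0 := by
    have : (Real.pi : ℂ) ≠ 0 := by exact_mod_cast Real.pi_ne_zero
    simp [this, Complex.I_ne_zero]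
  -- from `−2πi L_{m+2}/3 = −2πi L_m/3 + n·2πi`: `L_{m+2} − L_m = −3n`
  have hdiv : ((haggLabel s (m + 2) : ℤ) : ℂ) - (haggLabel s m : ℂ) = -3 * (n : ℂ) := by
    have key : (2 * (Real.pi : ℂ) * Complex.I) *
        ((haggLabel s (m + 2) : ℂ) - (haggLabel s m : ℂ) + 3 * n) = 0 := by
      linear_combination (-3 : ℂ) * hn
    rcases mul_eq_zero.1 key with h0 | h0
    · exact absurd h0 hπ
    · linear_combination h0
  have hint : s m + s (m + 1) = -3 * n := by
    have h1 : ((s m + s (m + 1) : ℤ) : ℂ) = ((-3 * n : ℤ) : ℂ) := by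
      push_cast
      rw [← hdiv, hL]
      push_cast
      ring
    exact_mod_cast h1
  rcases hs m with h0 | h0 <;> rcases hs (m + 1) with h1 | h1 <;> omega

/-- **Alternating word ⇒ rotated hcp** (landed c-layer algebra): if `s (m+1) = −s m` for all `m` then
`barlowStacking a h s` is `hcpStacking a h` up to a linear isometry (identity or half-turn). [folklore] -/
theorem exists_eq_image_hcp_of_alternating (a h : ℝ) {s : ℤ → ℤ} (hs : IsHaggSeq s)
    (halt : ∀ m, s (m + 1) = -s m) :
    ∃ B : E3 →ₗᵢ[ℝ] E3, barlowStacking a h s = B '' hcpStacking a h := by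
  have hmul : ∀ m, s m = s 0 * alternatingHagg m := CLayerWitnessWitness.eq_mul_alternatingHagg halt
  rcases hs 0 with h0 | h0
  · obtain rfl : s = alternatingHagg := funext fun m => by rw [hmul, h0, one_mul]
    exact ⟨LinearIsometry.id, by simp [hcpStacking]⟩
  · obtain rfl : s = fun m => -alternatingHagg m := funext fun m => by rw [hmul, h0]; ring
    exact ⟨halfTurn.toLinearIsometry, CLayerWitnessWitness.barlowStacking_neg_alternating a h⟩

/-- The rod `ξ₃ ↦ rodPoint a ξ₃` is an affine line: `rodPoint a ξ₃ = rodPoint a 0 + ξ₃ • e₃`. [folklore] -/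
theorem rodPoint_eq_add_smul (a ξ₃ : ℝ) :
    rodPoint a ξ₃ = rodPoint a 0 + ξ₃ • EuclideanSpace.single (2 : Fin 3) (1 : ℝ) := by
  ext i
  fin_cases i <;> simp [rodPoint]

/-- The rod is a smooth curve. [folklore] -/
theorem contDiff_rodPoint (a : ℝ) : ContDiff ℝ 2 (fun ξ₃ : ℝ => rodPoint a ξ₃) := by
  have : (fun ξ₃ : ℝ => rodPoint a ξ₃) =
      fun ξ₃ : ℝ => rodPoint a 0 + ξ₃ • EuclideanSpace.single (2 : Fin 3) (1 : ℝ) :=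
    funext fun ξ₃ => rodPoint_eq_add_smul a ξ₃
  rw [this]
  exact contDiff_const.add (contDiff_id.smul contDiff_const)

/-- **The selection clause read on the rod.**  Under clauses 7 of the certificate and the Fourier slice,
`𝓕 (rodProfile a K)` is `C²` and zero-free on `(1/(2h), 1/h) ∪ (−1/h, −1/(2h))`. [folklore] -/
theorem rod_hypotheses {a h : ℝ} (ha : 0 < a) (hh : 0 < h) {K : ℝ → ℝ}
    (hnv : ∀ v : E3, 4 / (3 * a ^ 2) + 1 / (4 * h ^ 2) < ‖v‖ ^ 2 →
      ‖v‖ ^ 2 < 4 / (3 * a ^ 2) + 1 / h ^ 2 → 𝓕 (fun y : E3 => (K ‖y‖ : ℂ)) v ≠ 0)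
    (hsm : ContDiffOn ℝ 2 (𝓕 (fun y : E3 => (K ‖y‖ : ℂ)))
      {v : E3 | 4 / (3 * a ^ 2) + 1 / (4 * h ^ 2) < ‖v‖ ^ 2 ∧ ‖v‖ ^ 2 < 4 / (3 * a ^ 2) + 1 / h ^ 2})
    (hslice : ∀ ξ₃ : ℝ, 𝓕 (rodProfile a K) ξ₃ = 𝓕 (fun y : E3 => (K ‖y‖ : ℂ)) (rodPoint a ξ₃)) :
    ContDiffOn ℝ 2 (𝓕 (rodProfile a K))
        (Set.Ioo (1 / (2 * h)) (1 / h) ∪ Set.Ioo (-(1 / h)) (-(1 / (2 * h)))) ∧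
      ∀ ξ ∈ Set.Ioo (1 / (2 * h)) (1 / h) ∪ Set.Ioo (-(1 / h)) (-(1 / (2 * h))),
        𝓕 (rodProfile a K) ξ ≠ 0 := by
  -- heights of the good intervals square into `(1/(4h²), 1/h²)`
  have hsq : ∀ ξ ∈ Set.Ioo (1 / (2 * h)) (1 / h) ∪ Set.Ioo (-(1 / h)) (-(1 / (2 * h))),
      1 / (4 * h ^ 2) < ξ ^ 2 ∧ ξ ^ 2 < 1 / h ^ 2 := by
    intro ξ hξ
    have e1 : (1 / (2 * h)) ^ 2 = 1 / (4 * h ^ 2) := by field_simp; ring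
    have e2 : (1 / h) ^ 2 = 1 / h ^ 2 := by rw [one_div, inv_pow, one_div]
    have hpos : 0 < 1 / (2 * h) := by positivity
    rcases hξ with ⟨h1, h2⟩ | ⟨h1, h2⟩
    · have hξ0 : 0 < ξ := hpos.trans h1
      refine ⟨?_, ?_⟩
      · rw [← e1]; exact pow_lt_pow_left₀ h1 hpos.le two_ne_zero
      · rw [← e2]; exact pow_lt_pow_left₀ h2 hξ0.le two_ne_zero
    · have hξ0 : 0 < -ξ := by linarith
      refine ⟨?_, ?_⟩
      · rw [← e1, ← neg_sq ξ]; exact pow_lt_pow_left₀ (by linarith) hpos.le two_ne_zero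
      · rw [← e2, ← neg_sq ξ]; exact pow_lt_pow_left₀ (by linarith) hξ0.le two_ne_zero
  have hmem : ∀ ξ ∈ Set.Ioo (1 / (2 * h)) (1 / h) ∪ Set.Ioo (-(1 / h)) (-(1 / (2 * h))),
      rodPoint a ξ ∈ {v : E3 | 4 / (3 * a ^ 2) + 1 / (4 * h ^ 2) < ‖v‖ ^ 2 ∧
        ‖v‖ ^ 2 < 4 / (3 * a ^ 2) + 1 / h ^ 2} := by
    intro ξ hξ
    obtain ⟨h1, h2⟩ := hsq ξ hξ
    simp only [Set.mem_setOf_eq, norm_rodPoint_sq ha.ne']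
    exact ⟨by linarith, by linarith⟩
  have hfun : 𝓕 (rodProfile a K) = fun ξ₃ => 𝓕 (fun y : E3 => (K ‖y‖ : ℂ)) (rodPoint a ξ₃) :=
    funext hslice
  refine ⟨?_, fun ξ hξ => ?_⟩
  · rw [hfun]
    exact hsm.comp (contDiff_rodPoint a).contDiffOn fun ξ hξ => hmem ξ hξ
  · rw [hslice]
    have := hmem ξ hξ
    exact hnv _ this.1 this.2

/-! ### The transfer -/

/-- **The transfer `LocalisedCertificate ⇒ SlackRigidity`, kernel-checked** (composition of line
`signed-root-silent-field`; the hypothesis is the statement of the line's only open stub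
`stub_certificate`, verbatim).  Witness `P := hcpPeriodicConfiguration a h`.  If `RigidFor P` failed:
thinning + rooting-with-field (fed by the trial-state bound) give a rooted bad sequence of vanishing
three-channel local slack; its local limit is a `1/3`-separated `Y ∋ 0`, `F`-tight, `U`-tight, SILENT and
unmatched at `(R+1, ε/2)`; the weak tight locus makes every `6a/5`-star of `Y` an exact rotated Barlow
star, so the layering theorem gives `Y = A '' barlowStacking a h s` (`A` linear); silence passes to the
stacking, unfolds on the torus sections into `Σ_k ω^{L_k} c_G(t − kh) = 0`, and the 1-D spectral lemma
(its hypotheses on `c_G = rodProfile a K` being the rod-profile regularity and — through the Fourier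
slice — the certificate's selection clause) makes `ω^{L_k}` two-periodic; the word alternates, the
stacking is a rotated `hcpStacking a h`, and `Y` IS root-matched — contradiction. [folklore] -/
theorem slackRigidity_of_localisedCertificate :
    (∃ (a h : ℝ) (ha : 0 < a) (hh : 0 < h), 0.775 * a < h ∧ h < 0.894 * a ∧
    ∃ (ρ c ρ' CK : ℝ) (g U f K : ℝ → ℝ) (F : Set E3 → ℝ),
      (∀ r : ℝ, 0 < r → lennardJones r = g r + U r + f r) ∧
      (∀ r : ℝ, 0 < r → 0 ≤ U r) ∧
      ContinuousOn U (Set.Ioi 0) ∧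
      (∀ r : ℝ, ρ ≤ r → g r = 0) ∧
      (∀ u v : E3, Integrable (fun y : E3 => K ‖y - u‖ * K ‖y - v‖)) ∧
      (∀ u v : E3, f (dist u v) = ∫ y : E3, K ‖y - u‖ * K ‖y - v‖) ∧
      Continuous K ∧
      (∀ r : ℝ, 0 ≤ r → |K r| ≤ CK / (1 + r) ^ 4) ∧
      (∀ T : Set E3, 0 ≤ F T) ∧
      (∀ (N : ℕ) (x : Fin N → E3), Function.Injective x →
        ∑ i, F (((fun z => z - x i) '' Set.range x) ∩ Metric.closedBall 0 ρ') ≤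
          interactionEnergy g x + c * N) ∧
      (∀ ε : ℝ, 0 < ε → ∃ η : ℝ, 0 < η ∧ ∀ S T : Set E3,
        (∀ p ∈ S, ∀ q ∈ S, p ≠ q → (1 / 3 : ℝ) ≤ dist p q) →
        (∀ p ∈ T, ∀ q ∈ T, p ≠ q → (1 / 3 : ℝ) ≤ dist p q) →
        (0 : E3) ∈ S → (0 : E3) ∈ T → BallMatch η (ρ' + 1) 0 S T →
        |F (S ∩ Metric.closedBall 0 ρ') - F (T ∩ Metric.closedBall 0 ρ')| ≤ ε) ∧
      c + f 0 / 2 = -((hcpPeriodicConfiguration ha.ne' hh.ne').energyPerParticle lennardJones) ∧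
      (∀ T : Set E3, (∀ p ∈ T, ∀ q ∈ T, p ≠ q → (1 / 3 : ℝ) ≤ dist p q) → (0 : E3) ∈ T →
        F (T ∩ Metric.closedBall 0 ρ') = 0 →
        (∀ p ∈ T, ∀ q ∈ T, ‖p‖ ≤ ρ' → ‖q‖ ≤ ρ' → p ≠ q → U (dist p q) = 0) →
        ∃ s : ℤ → ℤ, IsHaggSeq s ∧ ∃ B : E3 →ₗᵢ[ℝ] E3,
          T ∩ Metric.closedBall 0 (6 * a / 5) =
            B '' (barlowStacking a h s ∩ Metric.closedBall 0 (6 * a / 5))) ∧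
      (∀ v : E3, 4 / (3 * a ^ 2) + 1 / (4 * h ^ 2) < ‖v‖ ^ 2 →
        ‖v‖ ^ 2 < 4 / (3 * a ^ 2) + 1 / h ^ 2 → 𝓕 (fun y : E3 => (K ‖y‖ : ℂ)) v ≠ 0) ∧
      ContDiffOn ℝ 2 (𝓕 (fun y : E3 => (K ‖y‖ : ℂ)))
        {v : E3 | 4 / (3 * a ^ 2) + 1 / (4 * h ^ 2) < ‖v‖ ^ 2 ∧ ‖v‖ ^ 2 < 4 / (3 * a ^ 2) + 1 / h ^ 2}) →
    SlackRigidity := by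
  classical
  rintro ⟨a, h, ha, hh, hw1, hw2, ρ, c, ρ', CK, g, U, f, K, F, hsplit, hU0, hUc, hg0, hsmi, hsm, hKc,
    hKd, hF0, hstar, hcont, hid, htight, hnv0, hsm0⟩
  rw [slackRigidity_iff]
  refine ⟨hcpPeriodicConfiguration ha.ne' hh.ne', ?_⟩
  by_contra hrig
  -- S3a (fed by the landed thinning and trial-state bound): a rooted bad sequence, small in 3 channels
  obtain ⟨R, ε, hR, hε, S, hSfin, hsep, h0, hbad, hsmall, hfield⟩ :=
    SignedRootRooting.stub_rootingField CLayerWitnessThinning.stub_thinning (hcpPeriodicConfiguration ha.ne' hh.ne') c ρ'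
      g U f K F hsplit hU0 hsmi hsm hKc hF0 hstar hid
      (ExcessDecayLiouvilleCoarseGrains.stub_trialBound _) hrig
  -- S3b: a zero-slack, silent local limit, unmatched at the root
  obtain ⟨Y, hYsep, hY0, hYF, hYU, hYsil, hYbad⟩ :=
    SignedRootLocalLimit.stub_localLimitField (hcpPeriodicConfiguration ha.ne' hh.ne') ρ' R ε CK U K F S hε hU0 hUc
      hF0 hcont hKc hKd hSfin hsep h0 hbad hsmall hfield
  -- weak tight locus: every `6a/5`-star of `Y` is an exact rotated Barlow star
  have hloc : ∀ y ∈ Y, ∃ s : ℤ → ℤ, IsHaggSeq s ∧ ∃ B : E3 →ₗᵢ[ℝ] E3,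
      ((fun z => z - y) '' Y) ∩ Metric.closedBall 0 (6 * a / 5) =
        B '' (barlowStacking a h s ∩ Metric.closedBall 0 (6 * a / 5)) := by
    intro y hy
    refine htight ((fun z => z - y) '' Y) (CLayerWitnessReduction.separated_image_sub hYsep y) ⟨y, hy, sub_self y⟩
      (hYF y hy) ?_
    rintro p ⟨p', hp', rfl⟩ q ⟨q', hq', rfl⟩ _ _ hpq
    have hne : p' ≠ q' := fun h => hpq (by rw [h])
    rw [dist_sub_right]
    exact hYU p' hp' q' hq' hne
  -- landed layering on the window: `Y` is one linearly rotated Barlow stacking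
  obtain ⟨s, hs, A, hYeq⟩ :=
    CLayerWitnessReduction.layering_of_exact_stars a h ha hh hw1 hw2 Y hY0 hloc
  -- silence of the stacking itself, unfolded on the torus sections (S5a)
  have hsilS : ∀ y : E3, HasSum (fun p : ↥(barlowStacking a h s) => K ‖y - (p : E3)‖) 0 := by
    apply silent_of_silent_image A
    rw [← hYeq]
    exact hYsil
  have hrod : ∀ t : ℝ, HasSum (fun k : ℤ => rodPhase s k * rodProfile a K (t - k * h)) 0 :=
    SignedRootUnfolding.stub_layerUnfolding a h CK ha hh K hKc hKd s hsilS
  -- the 1-D spectral lemma (S5d) with S5b, S5c and the selection clause: the phases are 2-periodic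
  obtain ⟨hcc, Cc, hdec⟩ := SignedRootProfile.stub_rodProfile a CK K hKc hKd
  obtain ⟨hsmooth, hnv⟩ := rod_hypotheses ha hh hnv0 hsm0 (SignedRootSlice.stub_rodSlice a CK K hKc hKd)
  have hper : ∀ k : ℤ, rodPhase s (k + 2) = rodPhase s k :=
    SignedRootRodLemma.stub_rodLemma h hh (rodPhase s) (rodProfile a K)
      ⟨1, fun k => (SignedRootSilentField.norm_rodPhase s k).le⟩ hcc ⟨Cc, hdec⟩ hsmooth hnv hrod
  -- hence the word alternates and the stacking is rotated hcp
  obtain ⟨B, hB⟩ := exists_eq_image_hcp_of_alternating a h hs (succ_eq_neg_of_rodPhase_periodic hs hper)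
  -- so `Y = (A ∘ B) '' P.points` is matched at the root: contradiction
  apply hYbad
  refine ⟨A.comp B, ?_, ?_⟩
  · intro p hp _
    refine ⟨A (B p), ?_, ?_⟩
    · rw [hYeq]
      refine ⟨B p, ?_, rfl⟩
      rw [hB]
      refine ⟨p, ?_, rfl⟩
      rwa [hcpPeriodicConfiguration_points] at hp
    · rw [LinearIsometry.coe_comp, Function.comp_apply, dist_self]
      exact (half_pos hε).le
  · intro q hq _
    rw [hYeq] at hq
    obtain ⟨x, hx, rfl⟩ := hq
    rw [hB] at hx
    obtain ⟨p, hp, rfl⟩ := hx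
    refine ⟨p, ?_, ?_⟩
    · rw [hcpPeriodicConfiguration_points]; exact hp
    · rw [LinearIsometry.coe_comp, Function.comp_apply, dist_self]
      exact (half_pos hε).le

end Summit.AtomisticToContinuum.Crystallization.Theorems.SignedRootReduction

end
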